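import Summits.QuantumFields.BalabanUV.T4Continuum.Support.B13TermHistEnvelope
import Summits.QuantumFields.BalabanUV.T4Continuum.Support.OutputRateOpHolomorphic

/-!
# NE5 ∕ U3 — O2-op, CAUCHY face AT ACTIVITY LEVEL for the B13 term family: the operator fibre envelope `OpFibreEnvelopeCl`
# of any step model whose output is the Ursell series `out 𝒯 inc act`, from slack + the displayed per-activity majorant∕budget
# + operator-LINE analyticity of the FACTORS (`ActOpLineAnalyticOn`) — the operator twin of `B13TermHistEnvelope`

Cell `pub-balaban`, T⁴ fan-out, `HOME/BINDER-OWNERS.md` row NE5; unit `b2b-balaban-t4-ne5-formalise-leaf-03` (NE5 formalisation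
swarm, LEAF PROVER 03, gen 5; follower of this lineage's `Support/B13TermHistEnvelope.lean` p210127 = the HISTORY Cauchy face at
activity level, DAG N63).  Summits-side bookkeeping under the LEAN PLACEMENT RULE (our work ⟶ `Summits/`).  HONEST FRAMING
(T4-DAG PAGE 1, verbatim in spirit): rung (B)+1 of the FINITE-VOLUME T⁴ programme — NOT infinite volume, NOT a mass gap, NOT
the Clay problem; `FlowStep.BetaPertH`, (B), (B^μ) do not occur; NE5 (`T4OutputRate.NE5`) is NOT PRINTED and NOT PROVED
(GAPS G-t4-U3-1; spine 0/9).  HONEST DEPENDENCY (cell line, verbatim): continuum YM on T⁴ ⇐ BetaPertH ∧ nine spine estimates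
(0/9 proved); BetaPertH ⇐ (D1) ∧ (D4) ∧ CAP+tail; G-an2-4 gates asym, D1 and NE2/3/4.

WHERE IT SITS.  Leaf L04 of the owner's skeleton (`SKELETON-NE5-P1.md`) is the two-species output wall W2, split by the termwise
leaf (`T4InputCauchyRateTermwise`) into the fibre envelopes `OpFibreEnvelopeCl M W κ G` (operator half, wall O2-op) and
`HistFibreEnvelopeCl M W κ G` (history half), consumed TOGETHER by the END `ne5_at_of_stepModel_fibreCl₂_scale_nat`, and produced
from termwise data by `opFibreEnvelopeCl_of_termwise_op` ∕ `histFibreEnvelopeCl_of_termwise_hist` (slack `BoxInClass`, `TermRep`,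
`TermBound`∕`TermBudget`, and `TermOpLineAnalytic` ∕ `TermHistLineAnalytic` respectively).  For the Ursell family `term 𝒯 inc act`
of row O1-d2 (leaf-08) the HISTORY half was produced at ACTIVITY level by this lineage (`B13TermHistEnvelope`: structure
`ActExpLinearOn` ⟹ `TermHistLineAnalytic` by leaf-08's `termHistLineAnalytic_of_actExpLinear`).  The OPERATOR half had no
activity-level producer: the owner's `OutputRateOpHolomorphic` (p213179) derives `TermOpLineAnalytic K T W` from the TERM-level
structure `TermOpHolomorphic K T W μ f 𝒪` (each TERM one dominated holomorphic parametric integral), and `OutputRateActOpFibre`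
(p213673) ∕ route P2's `B13TermOpSecant` (p212487) serve the SECANT currency `OpLipschitz`.  THIS FILE supplies the missing edge:
holomorphy along operator lines is closed under FINITE PRODUCTS, so line analyticity of the FACTORS gives it for the Ursell terms —
no structure is needed on this side — and the tree's producer then yields `OpFibreEnvelopeCl`; the factor-level hypothesis is in
turn the owner's term-level theorem APPLIED TO THE FACTOR FAMILY (each activity viewed as a one-term family).

WHAT IS PROVED (kernel; `[folklore]` throughout; nothing of the manuscripts under audit is asserted — every input is DATA, a
STRUCTURE shape or a displayed binder with a KIND locator, trigger c3∕c4∕c6):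
* §1 SHAPE `ActOpLineAnalyticOn 𝒯 act K W` ([analysis]; NOT PRINTED — printed KIND: the operators enter the (2.14) factors through
  the `σ(Δ)`-analytic constructions of [Balaban1988RG2Cluster] p. 5 ∕ p. 15 and the operator-replacement estimates (2.16)–(2.17)
  p. 16; asserted nowhere): the quantifier prefix of the tree's `TermOpLineAnalytic K T W` pushed down to the FACTORS of the
  tuples localizing at a step-`k` domain (as route P2 pushed `OpLipschitz` down to `ActOpLip`);
  **`termOpLineAnalytic_b13_of_act : ActOpLineAnalyticOn 𝒯 act K W → TermOpLineAnalytic K (term 𝒯 inc act) W`** (finite product).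
* §2 **`opFibreEnvelopeCl_b13_of_termBudget`** (X-blind currency: for ANY `M` with `M.Out = out 𝒯 inc act`, `BoxInClass ∧ TermBound κ a
  ∧ TermBudget a G ∧ ActOpLineAnalyticOn ⟹ OpFibreEnvelopeCl M W κ G` — the tree's `opFibreEnvelopeCl_of_termwise_op` with `TermRep`
  from leaf-04's `termRep_b13_of_termBudget` and `TermOpLineAnalytic` from §1) and **`opFibreEnvelopeCl_b13_of_actBound`** (per-domain
  currency: slack ∧ the activity NORM majorant `‖act Z j q.1 q.2‖ ≤ A k g U Z j` on the class ((2.38) KIND, displayed) ∧ the per-domain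
  budget `Summable (actMajorant (A k g U) k X) ∧ Σ'ᵢ actMajorant ≤ G·e^{−κd(X)}` ((2.41)∕[26] KIND, displayed) ∧ `ActOpLineAnalyticOn`
  ⟹ `OpFibreEnvelopeCl M W κ G` — verbatim the binder list of this lineage's `histFibreEnvelopeCl_b13_of_actBound` with
  `ActExpLinearOn` REPLACED by `ActOpLineAnalyticOn`; M-test `diffContOnCl_of_hasSum_majorant` along the operator path `(p.1 + ζu, h)`);
  the JOINT face **`fibreEnvelopesCl_b13_of_act`**: ONE majorant∕budget + `ActOpLineAnalyticOn` + `ActExpLinearOn` ⟹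
  `OpFibreEnvelopeCl M W κ G ∧ HistFibreEnvelopeCl M W κ G` — exactly the `hopF`∕`hhistF` pair of `ne5_at_of_stepModel_fibreCl₂_scale_nat`.
* §3 the same for the MODEL OF RECORD shape `B13Represents.Assembly.step` (`Out = out 𝒯 inc act` by `rfl`): `opFibreEnvelopeCl_step_of_actBound`,
  `fibreEnvelopesCl_step_of_act` (room ⟹ slack by leaf-09's `Assembly.boxInClass`; class `ballClass (selfCtr 𝔄.raw 𝔄.histRef) ROp RHist`).
* §4 STRUCTURAL SOURCES (no new integral shape): `factorFamily act` (each activity as a one-term family, DATA);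
  `actOpLineAnalyticOn_of_factorLine : TermOpLineAnalytic K (factorFamily act) W → ActOpLineAnalyticOn 𝒯 act K W` and hence
  **`actOpLineAnalyticOn_of_factorHolomorphic : TermOpHolomorphic K (factorFamily act) W μ f 𝒪 → ActOpLineAnalyticOn 𝒯 act K W`** —
  the OWNER's `termOpLineAnalytic_of_opHolomorphic` at the factor family: the operator Cauchy face of the B13 output reads
  `TermOpHolomorphic K (factorFamily act) …` ((H-rep) per ACTIVITY) ⟹ `ActOpLineAnalyticOn` ⟹ `TermOpLineAnalytic (term …)` ⟹
  `OpFibreEnvelopeCl` (`opFibreEnvelopeCl_b13_of_factorHolomorphic`), the Cauchy-route counterpart of p213673's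
  `ActOpIntegral ⟹ ActOpFibre ⟹ ActOpBound ∧ ActOpLip ⟹ OpLipschitz`.
WHAT IS *NOT* HERE (honest).  No estimate on Bałaban's objects; the wall O2-op (G-ne5p1-1′∕1″) is NOT discharged — it is RELOCATED to
the displayed activity-level shape `ActOpLineAnalyticOn` (resp. to the owner's `TermOpHolomorphic` at the factor family: the (H-rep)
dictionary and the MARGIN on the complex operator ball, NOT PRINTED); the END is not wired here (the `fibreCl₂` END's remaining
binders are the holder's).  CAVEAT (route P2's FINDING G-ne5p2-5, journal l.9940): on O1-b's typing `OpDatum = ℓ^∞(Species)` with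
x-indexed species, `TermOpHolomorphic (factorFamily act)`'s measurability clause `∀ o ∈ 𝒪, AEStronglyMeasurable (f … o) μ` has the
binder shape shown uninstantiable over non-discrete Ω — §4's second feeder inherits that status until the repair lands; §1–§3 and the
first feeder have no measurability clause.  Headline discipline (c5∕c6): «NE5 leaf L04-op Cauchy face RELOCATED to the activity level
(line form) for the Ursell family ∕ model of record — NOT discharged»; 0∕12 leaves instantiated on Bałaban's objects is unchanged by
this file.  0 sorry; axioms ⊆ {propext, Classical.choice, Quot.sound}.
-/

noncomputable section

open Metric Set MeasureTheory
open scoped BigOperators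

namespace Summit.QuantumFields.BalabanUV.T4Continuum.B13TermOpEnvelope

open Literature.MathematicalPhysics.QuantumFieldTheory.Balaban1983to89.T4OutputRate (Carriers)
open Literature.MathematicalPhysics.QuantumFieldTheory.Balaban1983to89.T4InputCauchyRateData (StepModel)
open Literature.MathematicalPhysics.QuantumFieldTheory.Balaban1983to89.T4InputCauchyRateSpecies
  (BoxInClass ClassBound ballClass opSegment_mem_box)
open Literature.MathematicalPhysics.QuantumFieldTheory.Balaban1983to89.T4InputCauchyRateTermwise
  (TermBound TermBudget TermOpLineAnalytic OpFibreEnvelopeCl HistFibreEnvelopeCl opFibreEnvelopeCl_of_termwise_op)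
open Summit.QuantumFields.BalabanUV.T4Continuum.B13StepTermFamily
  (TermIndexing ActData ActExpLinearOn term out coeff term_of_rel term_of_not_rel hasSum_term_out)
open Summit.QuantumFields.BalabanUV.T4Continuum.B13TermRep
  (actMajorant norm_term_le_actMajorant summable_term_of_actBound termRep_b13_of_termBudget classBound_b13_of_actBound)
open Summit.QuantumFields.BalabanUV.T4Continuum.B13TermHistEnvelope
  (diffContOnCl_of_hasSum_majorant histFibreEnvelopeCl_b13_of_actBound)
open Summit.QuantumFields.BalabanUV.T4Continuum.B13OpDatum (OpDatum)
open Summit.QuantumFields.BalabanUV.T4Continuum.B13Base (selfCtr)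
open Summit.QuantumFields.BalabanUV.T4Continuum.B13Represents (Assembly)
open Summit.QuantumFields.BalabanUV.T4Continuum.OutputRateOpHolomorphic (TermOpHolomorphic termOpLineAnalytic_of_opHolomorphic)

/-! ## §1 Operator-line analyticity of the FACTORS, and of the Ursell terms by finite products -/

section Line

variable {C : Carriers} {ι P J Op Hist : Type*} [NormedAddCommGroup Op] [NormedSpace ℂ Op] [NormedAddCommGroup Hist]
  [NormedSpace ℂ Hist] (𝒯 : TermIndexing C ι P J) (inc : P → P → Prop) [DecidableRel inc] (act : P → J → Op → Hist → ℂ)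

/-- HYPOTHESIS SHAPE `ActOpLineAnalyticOn 𝒯 act K W` ([analysis]; displayed, asserted nowhere; NOT PRINTED as a statement over an
input class — printed KIND: in the resummed term (2.14) p. 15 of [Balaban1988RG2Cluster] the operators enter each factor through the
`σ(Δ)`-analytic constructions of p. 5 ∕ p. 15 and are replaced under the estimates (2.16)–(2.17) p. 16; the cell's wall O2-op,
G-ne5p1-1′∕1″, RELOCATED to the factors, not discharged): along every complex OPERATOR segment `ζ ↦ (o + ζ•u, h)` whose closed unit
part lies in the class, every FACTOR `ζ ↦ act (poly i m) (lab i m) (o + ζ•u) h` of every tuple localizing at a step-`k` domain is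
complex differentiable on the closed unit disc — the quantifier prefix of the tree's `TermOpLineAnalytic K T W` pushed down to the
factors. [folklore] -/
def ActOpLineAnalyticOn (K : ℕ → (ℕ → ℝ) → C.BgB → Set (Op × Hist)) (W : Set (ℕ → ℝ)) : Prop :=
  ∀ k, ∀ g ∈ W, ∀ (U : C.BgB) (o u : Op) (h : Hist),
    (∀ ζ ∈ closedBall (0 : ℂ) 1, (o + ζ • u, h) ∈ K k g U) → ∀ X : C.Dom, C.scale X = k → ∀ i, 𝒯.Rel k i X → ∀ m,
      DifferentiableOn ℂ (fun ζ : ℂ => act (𝒯.poly i m) (𝒯.lab i m) (o + ζ • u) h) (closedBall 0 1)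

variable {𝒯 act}

omit [NormedAddCommGroup Hist] [NormedSpace ℂ Hist] in
/-- **FACTORS ⟹ TERMS, OPERATOR LINES** (the operator twin of leaf-08's `termHistLineAnalytic_of_actExpLinear`, with NO structure
needed on this side): a term is `coeff · Π_m act …` on the localization relation and `0` off it, and complex differentiability along
a line is closed under finite products — `ActOpLineAnalyticOn 𝒯 act K W ⟹ TermOpLineAnalytic K (term 𝒯 inc act) W`. [folklore] -/
theorem termOpLineAnalytic_b13_of_act {K : ℕ → (ℕ → ℝ) → C.BgB → Set (Op × Hist)} {W : Set (ℕ → ℝ)}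
    (hact : ActOpLineAnalyticOn 𝒯 act K W) : TermOpLineAnalytic K (term 𝒯 inc act) W := by
  intro k g hg U o u h hseg X hX i
  by_cases hR : 𝒯.Rel k i X
  · have hprod : DifferentiableOn ℂ (fun ζ : ℂ => ∏ m, act (𝒯.poly i m) (𝒯.lab i m) (o + ζ • u) h) (closedBall 0 1) :=
      DifferentiableOn.fun_finsetProd fun m _ => hact k g hg U o u h hseg X hX i hR m
    refine (hprod.const_mul (coeff 𝒯 inc i)).congr fun ζ _ => ?_
    exact term_of_rel 𝒯 inc act hR _ _
  · refine (differentiableOn_const (0 : ℂ)).congr fun ζ _ => ?_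
    exact term_of_not_rel 𝒯 inc act hR _ _

end Line

/-! ## §2 The Cauchy face at activity level: `OpFibreEnvelopeCl` from slack + displayed majorant + factor line analyticity -/

section Cauchy

variable {C : Carriers} {ι P J Op Hist Ω : Type*} [NormedAddCommGroup Op] [NormedSpace ℂ Op] [NormedAddCommGroup Hist]
  [NormedSpace ℂ Hist] [MeasurableSpace Ω] (𝒯 : TermIndexing C ι P J) (inc : P → P → Prop) [DecidableRel inc]
  (act : P → J → Op → Hist → ℂ)

/-- [folklore] **THE CAUCHY FACE OF L04-op AT ACTIVITY LEVEL, X-BLIND CURRENCY.**  For ANY step model whose output IS the Ursell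
series `out 𝒯 inc act`: the slack `BoxInClass M K W`, the termwise leaf's displayed majorant `TermBound K (term 𝒯 inc act) W κ a` with
budget `TermBudget a G` ((2.38) p. 20 ∕ (2.41) p. 21 KIND, locators only) and the factor line analyticity `ActOpLineAnalyticOn 𝒯 act K W`
([analysis], displayed) ⟹ `OpFibreEnvelopeCl M W κ G` — the tree's `opFibreEnvelopeCl_of_termwise_op` with `TermRep` (leaf-04's
`termRep_b13_of_termBudget`) and `TermOpLineAnalytic` (§1) supplied BY NAME. -/
theorem opFibreEnvelopeCl_b13_of_termBudget {M : StepModel C Op Hist}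
    (hM : ∀ k o h X, M.Out k o h X = out 𝒯 inc act k o h X) {K : ℕ → (ℕ → ℝ) → C.BgB → Set (Op × Hist)}
    {W : Set (ℕ → ℝ)} {κ G : ℝ} {a : ℕ → ι → ℝ} (hbox : BoxInClass M K W) (hbd : TermBound K (term 𝒯 inc act) W κ a)
    (hbud : TermBudget a G) (hact : ActOpLineAnalyticOn 𝒯 act K W) : OpFibreEnvelopeCl M W κ G :=
  opFibreEnvelopeCl_of_termwise_op hbox (termRep_b13_of_termBudget 𝒯 inc act hM hbd hbud) hbd hbud
    (termOpLineAnalytic_b13_of_act (inc := inc) hact)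

/-- [folklore] **THE CAUCHY FACE OF L04-op AT ACTIVITY LEVEL, PER-DOMAIN CURRENCY** (the binder list of this lineage's
`histFibreEnvelopeCl_b13_of_actBound` with the structure `ActExpLinearOn` REPLACED by the displayed `ActOpLineAnalyticOn`): for ANY
step model with `M.Out = out 𝒯 inc act`: the slack `BoxInClass M K W`; the activity NORM majorant on the class — at every class point
`q` of step `k`, every factor of every tuple localizing at a step-`k` domain has `‖act Z j q.1 q.2‖ ≤ A k g U Z j` ((2.38) p. 20 KIND;
displayed); the PER-DOMAIN budget `Summable (actMajorant (A k g U) k X) ∧ Σ'ᵢ actMajorant … ≤ G·e^{−κd(X)}` ((2.41) p. 21 KIND;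
displayed); and `ActOpLineAnalyticOn 𝒯 act K W` ⟹ `OpFibreEnvelopeCl M W κ G`.  Along an operator segment through a base point the
segment lies in the class (slack, `opSegment_mem_box`), the output there is the sum of its Ursell terms (d3), each analytic along
the segment (§1) and dominated by the summable per-domain majorant (M-test `diffContOnCl_of_hasSum_majorant`); the envelope on the
closed disc is leaf-04's `classBound_b13_of_actBound`. -/
theorem opFibreEnvelopeCl_b13_of_actBound {M : StepModel C Op Hist}
    (hM : ∀ k o h X, M.Out k o h X = out 𝒯 inc act k o h X) {K : ℕ → (ℕ → ℝ) → C.BgB → Set (Op × Hist)}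
    {W : Set (ℕ → ℝ)} {A : ℕ → (ℕ → ℝ) → C.BgB → P → J → ℝ} {κ G : ℝ} (hbox : BoxInClass M K W)
    (hA : ∀ k, ∀ g ∈ W, ∀ (U : C.BgB) (q : Op × Hist), q ∈ K k g U → ∀ X : C.Dom, C.scale X = k →
      ∀ i, 𝒯.Rel k i X → ∀ m, ‖act (𝒯.poly i m) (𝒯.lab i m) q.1 q.2‖ ≤ A k g U (𝒯.poly i m) (𝒯.lab i m))
    (hbud : ∀ k, ∀ g ∈ W, ∀ (U : C.BgB) (X : C.Dom), C.scale X = k →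
      Summable (actMajorant 𝒯 inc (A k g U) k X) ∧ ∑' i, actMajorant 𝒯 inc (A k g U) k X i ≤ G * Real.exp (-(κ * C.d X)))
    (hact : ActOpLineAnalyticOn 𝒯 act K W) : OpFibreEnvelopeCl M W κ G := by
  have hcb : ClassBound M K W κ G := classBound_b13_of_actBound hM hA hbud
  have hline : TermOpLineAnalytic K (term 𝒯 inc act) W := termOpLineAnalytic_b13_of_act (inc := inc) hact
  intro k g hg U p hp X hX h hh u hu
  have hseg : ∀ ζ ∈ closedBall (0 : ℂ) 1, (p.1 + ζ • u, h) ∈ K k g U :=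
    fun ζ hζ => hbox k g hg U p hp (opSegment_mem_box hh hu hζ)
  refine ⟨?_, fun ζ hζ => hcb k g hg U _ (hseg ζ hζ) X hX⟩
  obtain ⟨hs, -⟩ := hbud k g hg U X hX
  refine diffContOnCl_of_hasSum_majorant (F := fun i ζ => term 𝒯 inc act k i (p.1 + ζ • u) h X)
    (f := fun ζ => M.Out k (p.1 + ζ • u) h X) hs (fun ζ hζ => ?_) (fun i ζ hζ => ?_) fun i => hline k g hg U p.1 u h hseg X hX i
  · rw [hM]
    exact hasSum_term_out 𝒯 inc act (summable_term_of_actBound (hA k g hg U _ (hseg ζ hζ) X hX) hs)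
  · exact norm_term_le_actMajorant (hA k g hg U _ (hseg ζ hζ) X hX i)

/-- [folklore] **BOTH FIBRE ENVELOPES AT ACTIVITY LEVEL FROM ONE MAJORANT∕BUDGET** — the `hopF`∕`hhistF` pair of the tree's END
`ne5_at_of_stepModel_fibreCl₂_scale_nat` for any `M` with `M.Out = out 𝒯 inc act`: slack + activity norm majorant + per-domain budget
+ `ActOpLineAnalyticOn` (operator half, [analysis], displayed) + leaf-08's STRUCTURE `ActExpLinearOn` (history half) ⟹
`OpFibreEnvelopeCl M W κ G ∧ HistFibreEnvelopeCl M W κ G` (§2 + this lineage's `histFibreEnvelopeCl_b13_of_actBound`). -/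
theorem fibreEnvelopesCl_b13_of_act {M : StepModel C Op Hist}
    (hM : ∀ k o h X, M.Out k o h X = out 𝒯 inc act k o h X) {K : ℕ → (ℕ → ℝ) → C.BgB → Set (Op × Hist)}
    {W : Set (ℕ → ℝ)} {A : ℕ → (ℕ → ℝ) → C.BgB → P → J → ℝ} {κ G : ℝ} {D : ActData P J Op Hist Ω}
    (hbox : BoxInClass M K W)
    (hA : ∀ k, ∀ g ∈ W, ∀ (U : C.BgB) (q : Op × Hist), q ∈ K k g U → ∀ X : C.Dom, C.scale X = k →
      ∀ i, 𝒯.Rel k i X → ∀ m, ‖act (𝒯.poly i m) (𝒯.lab i m) q.1 q.2‖ ≤ A k g U (𝒯.poly i m) (𝒯.lab i m))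
    (hbud : ∀ k, ∀ g ∈ W, ∀ (U : C.BgB) (X : C.Dom), C.scale X = k →
      Summable (actMajorant 𝒯 inc (A k g U) k X) ∧ ∑' i, actMajorant 𝒯 inc (A k g U) k X i ≤ G * Real.exp (-(κ * C.d X)))
    (hact : ActOpLineAnalyticOn 𝒯 act K W) (hexp : ActExpLinearOn 𝒯 act D K W) :
    OpFibreEnvelopeCl M W κ G ∧ HistFibreEnvelopeCl M W κ G :=
  ⟨opFibreEnvelopeCl_b13_of_actBound 𝒯 inc act hM hbox hA hbud hact,
    histFibreEnvelopeCl_b13_of_actBound 𝒯 inc act hM hbox hA hbud hexp⟩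

end Cauchy

/-! ## §3 The Cauchy face for the MODEL OF RECORD shape `B13Represents.Assembly.step` -/

section ModelOfRecord

variable {C : Carriers} {E IOp Hist ι P J Ω : Type*} [NormedAddCommGroup Hist] [NormedSpace ℂ Hist] [MeasurableSpace Ω]
  (𝔄 : Assembly C E IOp Hist ι P J) (BHist : ℕ → ℝ)

/-- [folklore] **L04-op, CAUCHY FACE, FOR THE ASSEMBLED STEP MODEL** (`Out = out 𝒯 inc act` by `rfl`): ROOM `rOp ≤ ROp`,
`BHist + rHist ≤ RHist` (⟹ slack, leaf-09's `Assembly.boxInClass`) + the activity norm majorant and per-domain budget on the ball class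
`ballClass (selfCtr 𝔄.raw 𝔄.histRef) ROp RHist` (displayed, (2.38)∕(2.41) KIND) + `ActOpLineAnalyticOn` on that class ([analysis],
displayed) ⟹ `OpFibreEnvelopeCl (𝔄.step BHist) W κ G`. -/
theorem opFibreEnvelopeCl_step_of_actBound {W : Set (ℕ → ℝ)} {ROp RHist : ℕ → ℝ}
    {A : ℕ → (ℕ → ℝ) → C.BgB → P → J → ℝ} {κ G : ℝ}
    (hOp : ∀ k, 𝔄.rOp k ≤ ROp k) (hHist : ∀ k, BHist k + 𝔄.rHist k ≤ RHist k)
    (hA : ∀ k, ∀ g ∈ W, ∀ (U : C.BgB) (q : OpDatum E × Hist), q ∈ ballClass (selfCtr 𝔄.raw 𝔄.histRef) ROp RHist k g U →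
      ∀ X : C.Dom, C.scale X = k → ∀ i, 𝔄.𝒯.Rel k i X → ∀ m,
        ‖𝔄.act (𝔄.𝒯.poly i m) (𝔄.𝒯.lab i m) q.1 q.2‖ ≤ A k g U (𝔄.𝒯.poly i m) (𝔄.𝒯.lab i m))
    (hbud : ∀ k, ∀ g ∈ W, ∀ (U : C.BgB) (X : C.Dom), C.scale X = k →
      Summable (actMajorant 𝔄.𝒯 𝔄.inc (A k g U) k X) ∧
        ∑' i, actMajorant 𝔄.𝒯 𝔄.inc (A k g U) k X i ≤ G * Real.exp (-(κ * C.d X)))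
    (hact : ActOpLineAnalyticOn 𝔄.𝒯 𝔄.act (ballClass (selfCtr 𝔄.raw 𝔄.histRef) ROp RHist) W) :
    OpFibreEnvelopeCl (𝔄.step BHist) W κ G :=
  opFibreEnvelopeCl_b13_of_actBound 𝔄.𝒯 𝔄.inc 𝔄.act (fun _ _ _ _ => rfl) (𝔄.boxInClass BHist W hOp hHist) hA hbud hact

/-- [folklore] **BOTH FIBRE ENVELOPES FOR THE ASSEMBLED STEP MODEL** from room + ONE majorant∕budget + `ActOpLineAnalyticOn` +
`ActExpLinearOn` on the ball class — the `hopF`∕`hhistF` pair of `ne5_at_of_stepModel_fibreCl₂_scale_nat` at `M := 𝔄.step BHist`. -/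
theorem fibreEnvelopesCl_step_of_act {W : Set (ℕ → ℝ)} {ROp RHist : ℕ → ℝ}
    {A : ℕ → (ℕ → ℝ) → C.BgB → P → J → ℝ} {κ G : ℝ} {D : ActData P J (OpDatum E) Hist Ω}
    (hOp : ∀ k, 𝔄.rOp k ≤ ROp k) (hHist : ∀ k, BHist k + 𝔄.rHist k ≤ RHist k)
    (hA : ∀ k, ∀ g ∈ W, ∀ (U : C.BgB) (q : OpDatum E × Hist), q ∈ ballClass (selfCtr 𝔄.raw 𝔄.histRef) ROp RHist k g U →
      ∀ X : C.Dom, C.scale X = k → ∀ i, 𝔄.𝒯.Rel k i X → ∀ m,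
        ‖𝔄.act (𝔄.𝒯.poly i m) (𝔄.𝒯.lab i m) q.1 q.2‖ ≤ A k g U (𝔄.𝒯.poly i m) (𝔄.𝒯.lab i m))
    (hbud : ∀ k, ∀ g ∈ W, ∀ (U : C.BgB) (X : C.Dom), C.scale X = k →
      Summable (actMajorant 𝔄.𝒯 𝔄.inc (A k g U) k X) ∧
        ∑' i, actMajorant 𝔄.𝒯 𝔄.inc (A k g U) k X i ≤ G * Real.exp (-(κ * C.d X)))
    (hact : ActOpLineAnalyticOn 𝔄.𝒯 𝔄.act (ballClass (selfCtr 𝔄.raw 𝔄.histRef) ROp RHist) W)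
    (hexp : ActExpLinearOn 𝔄.𝒯 𝔄.act D (ballClass (selfCtr 𝔄.raw 𝔄.histRef) ROp RHist) W) :
    OpFibreEnvelopeCl (𝔄.step BHist) W κ G ∧ HistFibreEnvelopeCl (𝔄.step BHist) W κ G :=
  fibreEnvelopesCl_b13_of_act 𝔄.𝒯 𝔄.inc 𝔄.act (fun _ _ _ _ => rfl) (𝔄.boxInClass BHist W hOp hHist) hA hbud hact hexp

end ModelOfRecord

/-! ## §4 Structural sources: the owner's term-level shapes APPLIED TO THE FACTOR FAMILY -/

section Factor

variable {C : Carriers} {ι P J Op Hist : Type*} [NormedAddCommGroup Op] [NormedSpace ℂ Op] [NormedAddCommGroup Hist]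
  [NormedSpace ℂ Hist] (𝒯 : TermIndexing C ι P J) (inc : P → P → Prop) [DecidableRel inc] (act : P → J → Op → Hist → ℂ)

variable {𝒯 inc} in
/-- [folklore] DATA: the FACTOR FAMILY of an activity — each activity `act Z j` viewed as a one-term family indexed by `(Z, j)` (no step,
no localization domain), so that the termwise leaf's and the owner's TERM-level shapes (`TermOpLineAnalytic`, `TermOpHolomorphic`, …)
apply to the factors verbatim. -/
def factorFamily : ℕ → P × J → Op → Hist → C.Dom → ℂ := fun _ zj o h _ => act zj.1 zj.2 o h

variable {act}

omit [NormedAddCommGroup Op] [NormedSpace ℂ Op] [NormedAddCommGroup Hist] [NormedSpace ℂ Hist] in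
/-- [folklore] `factorFamily` unfolded. -/
@[simp] theorem factorFamily_apply (k : ℕ) (zj : P × J) (o : Op) (h : Hist) (X : C.Dom) :
    factorFamily act k zj o h X = act zj.1 zj.2 o h := rfl

omit [NormedAddCommGroup Hist] [NormedSpace ℂ Hist] in
/-- [folklore] **FACTOR FAMILY LINE-ANALYTIC ⟹ `ActOpLineAnalyticOn`**: operator-line analyticity of EVERY activity (the tree's
`TermOpLineAnalytic` at the factor family) restricts to the factors of the tuples that occur. -/
theorem actOpLineAnalyticOn_of_factorLine {K : ℕ → (ℕ → ℝ) → C.BgB → Set (Op × Hist)} {W : Set (ℕ → ℝ)}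
    (hfac : TermOpLineAnalytic K (factorFamily act) W) : ActOpLineAnalyticOn 𝒯 act K W :=
  fun k g hg U o u h hseg X hX i _ m => hfac k g hg U o u h hseg X hX (𝒯.poly i m, 𝒯.lab i m)

omit [NormedAddCommGroup Hist] [NormedSpace ℂ Hist] in
/-- [folklore] **(H-rep) PER ACTIVITY ⟹ `ActOpLineAnalyticOn`** — the OWNER's `OutputRateOpHolomorphic.termOpLineAnalytic_of_opHolomorphic`
APPLIED AT THE FACTOR FAMILY: if at every class point each activity is a dominated holomorphic parametric integral of the operator
datum on a domain containing the class's operator section (`TermOpHolomorphic K (factorFamily act) W μ f 𝒪`), the factors are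
operator-line analytic on the class.  (CAVEAT G-ne5p2-5: on ℓ^∞-typed x-indexed species the measurability clause of
`TermOpHolomorphic` is the binder shape shown uninstantiable over non-discrete Ω; see the header.) -/
theorem actOpLineAnalyticOn_of_factorHolomorphic {K : ℕ → (ℕ → ℝ) → C.BgB → Set (Op × Hist)} {W : Set (ℕ → ℝ)}
    {α : ℕ → P × J → Type*} [∀ k zj, MeasurableSpace (α k zj)] {μ : ∀ k zj, Hist → C.Dom → Measure (α k zj)}
    {f : ∀ k zj, Hist → C.Dom → Op → α k zj → ℂ} {𝒪 : ℕ → (ℕ → ℝ) → C.BgB → Hist → Set Op}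
    (hhol : TermOpHolomorphic K (factorFamily act) W μ f 𝒪) : ActOpLineAnalyticOn 𝒯 act K W :=
  actOpLineAnalyticOn_of_factorLine 𝒯 (termOpLineAnalytic_of_opHolomorphic hhol)

variable (act) in
/-- [folklore] **THE WHOLE OPERATOR CAUCHY CHAIN AT ACTIVITY LEVEL**: `TermOpHolomorphic K (factorFamily act)` ((H-rep) per activity)
+ slack + activity norm majorant + per-domain budget ⟹ `OpFibreEnvelopeCl M W κ G` for any `M` with `M.Out = out 𝒯 inc act`
(§4 ∘ §2) — the Cauchy-route counterpart of `OutputRateActOpFibre`'s `ActOpIntegral ⟹ … ⟹ OpLipschitz`. -/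
theorem opFibreEnvelopeCl_b13_of_factorHolomorphic {M : StepModel C Op Hist}
    (hM : ∀ k o h X, M.Out k o h X = out 𝒯 inc act k o h X) {K : ℕ → (ℕ → ℝ) → C.BgB → Set (Op × Hist)}
    {W : Set (ℕ → ℝ)} {A : ℕ → (ℕ → ℝ) → C.BgB → P → J → ℝ} {κ G : ℝ}
    {α : ℕ → P × J → Type*} [∀ k zj, MeasurableSpace (α k zj)] {μ : ∀ k zj, Hist → C.Dom → Measure (α k zj)}
    {f : ∀ k zj, Hist → C.Dom → Op → α k zj → ℂ} {𝒪 : ℕ → (ℕ → ℝ) → C.BgB → Hist → Set Op}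
    (hbox : BoxInClass M K W)
    (hA : ∀ k, ∀ g ∈ W, ∀ (U : C.BgB) (q : Op × Hist), q ∈ K k g U → ∀ X : C.Dom, C.scale X = k →
      ∀ i, 𝒯.Rel k i X → ∀ m, ‖act (𝒯.poly i m) (𝒯.lab i m) q.1 q.2‖ ≤ A k g U (𝒯.poly i m) (𝒯.lab i m))
    (hbud : ∀ k, ∀ g ∈ W, ∀ (U : C.BgB) (X : C.Dom), C.scale X = k →
      Summable (actMajorant 𝒯 inc (A k g U) k X) ∧ ∑' i, actMajorant 𝒯 inc (A k g U) k X i ≤ G * Real.exp (-(κ * C.d X)))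
    (hhol : TermOpHolomorphic K (factorFamily act) W μ f 𝒪) : OpFibreEnvelopeCl M W κ G :=
  opFibreEnvelopeCl_b13_of_actBound 𝒯 inc act hM hbox hA hbud (actOpLineAnalyticOn_of_factorHolomorphic 𝒯 hhol)

end Factor

end Summit.QuantumFields.BalabanUV.T4Continuum.B13TermOpEnvelope

end
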